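import Mathlib
import HarnessLib
import HarnessLib.Audit
import Summits.AtomisticToContinuum.Statement
import Literature.MathematicalPhysics.StatisticalMechanics.LennardJonesClusters
import Summits.AtomisticToContinuum.Crystallization.Theorems.ExcessDecayLiouvilleCrysEnergyLimit
import Summits.AtomisticToContinuum.Crystallization.Theorems.ThreeConeCertificateTrialStateUpper
import Summits.AtomisticToContinuum.Crystallization.Theorems.ThreeConeCertificateDefectVanishCrystallizes
import HarnessLib.Audit.Status.Attr

/-!
Route: FrustrationRangeCertificates

# Route FrustrationRangeCertificates — finite-level transfer certificates pricing non-hcp patterns —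
the LP dual of unimodular rigidity decides LJ crystallization by counting

It suffices to show X := PATTERN-PRICED TRANSFER CERTIFICATES AT FINITE LEVEL (decl
PatternPricedCertificates; conforming gen-2 realisation of card frustration-range-lp-hierarchy,
replacing the retired route FrustrationRangeLP whose assembly ended at the Literature decl). There
is ONE periodic configuration P of ℝ³ (intended: the relaxed hcp crystal, 0 ∈ P.points) such that
for every pattern test (R, ε) and every defect budget θ > 0 there are a separation δ > 0 obeyed by
all Lennard-Jones ground states (δ = 1/3 is proved: LennardJonesMinimalDistance_holds), a level L,
constants c and κ ∈ (0, 1], a periodic Q with e(Q) ≤ c + κθ, and a PATTERN-LOCAL TRANSFER RULE Φ(v,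
pat_L(i), pat_L(j)) (energy sent from particle i to particle j at relative position v, allowed to
depend only on the two L-neighbourhood patterns) such that on EVERY finite δ-separated configuration
and at every particle i:  ½ Σ_{j≠i} V_LJ(|x_i − x_j|) + Σ_{j≠i} [Φ(i→j) − Φ(j→i)] ≥ c + κ·1[the (R,
ε)-pattern of i is NOT an isometric copy of P's], the bracket being verbatim the defect predicate of
the shared hinge BulkDefectVanish (stmt-0751). Transfers are antisymmetric, hence zero-sum on every
finite configuration, so for a ground state N·c + κ·#bad ≤ E(N): with the trial-state upper bound
(TrialStateUpper) this gives BulkDefectVanish (support CertificatesDefectVanish, pure counting) and,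
through κ ≤ 1, E(N)/N → ⨅ periodic e (support CertificatesEnergyLimit); with the shared attainment
item CrysPeriodicMinAttained (stmt-0627) and the soft assembly lemma DefectVanishCrystallizes
(stmt-0752) this is `Crystallization` (deciding theorem `closes`, sorry-free in the planner's
Sketch.lean, axioms propext/choice/Quot.sound). WHY THIS IS AN LP ROUTE: by transfer/marginal
duality (crux TransferDuality, filed informally after open) the best constant certifiable at level L
with price κ equals the minimum of E_𝐏[h(root)] − κ·𝐏(root bad) over rooted laws consistent under
mass transport for L-local pattern tests (continuum Kaburagi–Kanamori configurational polytope;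
m-potentials ↔ zero-sum transfers, Holsztyński–Slawny); levels increase to the point-stationary
value, so X ⇔ [every minimising point-stationary hard-core law is P-patterned] = the primal twin
PalmRigidity (stmt-9224, route PalmUnimodularRigidity) PLUS finiteness of the level, and R*(R, ε, θ)
:= the first level admitting a certificate is the FRUSTRATION RANGE of Lennard-Jones; the primal
optima at low levels (frustrated icosahedral / polytetrahedral pseudo-laws) are the refutation
engine. Its periodic shadow is crux PeriodicDefectPrice.
Lean: `PatternPricedCertificates ∧ TrialStateUpper ∧ CrysPeriodicMinAttained`

## Assembly
Pure logic plus the PROVED Literature fact LennardJonesMinimalDistance_holds (imported via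
LennardJonesClusters): from CrysPeriodicMinAttained take P_min with IsLeast; CertificatesEnergyLimit
gives E(N)/N → ⨅ = e(P_min) (IsLeast.csInf_eq after `← sInf_range`), i.e.
HasPeriodicGroundStateEnergy; CertificatesDefectVanish gives BulkDefectVanish and
DefectVanishCrystallizes with LennardJonesMinimalDistance_holds gives IsCrystallizing; the pair is
`_root_.Crystallization`. The deciding theorem `closes` (glue.lean) takes all ten items as
hypotheses and is this five-line term (checked sorry-free, axioms propext / Classical.choice /
Quot.sound, in Sketch.lean).

Rationale: WHY THIS LINE. Every proved crystallization theorem for realistic potentials rests on a LOCAL energy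
inequality
"e_loc ≥ e*" (Theil2006, FlatleyTheil2015 with a three-body crutch; BlancLewin2015 §2.3), and a
localised energy with zero-sum corrections is exactly a DUAL CERTIFICATE: m-potential ↔ transfers
(HolsztynskiSlawny1978; non-existence at finite range: Miekisz1993, Miekisz1998), score functions
with transfers for packings (Lagarias2002LocalDensity, Hales2012), "relieving frustration" by
cluster re-weighting found by an LP for frustrated Ising models (VanheckeEtAl2021 =
arXiv:2006.14341); its existence at level L is equivalent to tightness of a PRIMAL relaxation over
mass-transport-consistent rooted pattern laws (KaburagiKanamori1975's configurational polytope, run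
as certified hierarchies on ℤ^d by HuangEtAl2016 and KullEtAl2024; continuum pair/k-point levels
without locality: CohnKumar2006, TorquatoStillinger2006, Li2022, DelaatVallentin2014, Laat2016,
CohnLaatSalmon2022). Imported areas: LP/convex duality and Sherali–Adams-type marginal hierarchies
(lattice ground-state and alloy theory), unimodular/Palm point processes (mass transport,
AldousLyons2007, LastThorisson2009), certified computation (interval LP, column generation),
Flyspeck-type local inequalities. What it does that prior routes do not: (i) unlike the retired
FrustrationRangeLP (first-shell coordination certificates + a borrowed kissing back end) the
certificate family prices the verbatim defect predicate of the shared hinge 0751 at every scale, so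
the whole passage finite N → limit is COUNTING (no Benjamini–Schramm limit, no Palm inversion, no
portmanteau, in contrast to the primal twin PalmUnimodularRigidity), and κ ≤ 1 makes the same
statement deliver the energy limit 0626; (ii) the budget clause is ⨅-free (e(Q) ≤ c + κθ for a
periodic witness Q), so no BddBelow junk enters; (iii) exact finite-range certificates (the card's
literal X) are refutable through the r⁻⁶ tail (far density of indefinite local effect) — the defect
budget θ and unbounded-range but pattern-local transfers are the repair; (iv) no refuted statement
of the negatives index is approached (the certificate prices metric ε-matching to P-patterns, never
"soft kissing ⇒ fcc/hcp contact graph", cf. negative 4146 / DecahedralSoftShell).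

RANKED CRUXES. #2 PatternPricedCertificates (crux) — thesis X (card items B1+B4, dual side): one
periodic P such that for all R, ε, θ > 0 there are δ > 0 (valid for all LJ ground states), a level
L, c, κ ∈ (0,1], a pattern-local transfer rule Φ and a periodic Q with e(Q) ≤ c + κθ, such that
pointwise on every finite δ-separated configuration ½Σ_j V_LJ + (zero-sum transfers) ≥ c +
κ·1[(R,ε)-pattern of i not an isometric copy of P's] (predicate verbatim from stmt-0751).
[difficulty: open-problem] (why it might fail: Needs LJ's periodic minimiser pattern-unique with a
POSITIVE price on every non-P environment at every scale (stacking: ~3e-5/R per site) and level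
values reaching the budget at finite L; a degenerate or aperiodic optimal stacking, a zero-cost
defect, or an infinite-level duality gap kills it.) [HolsztynskiSlawny1978, KaburagiKanamori1975,
KullEtAl2024, HuangEtAl2016, Hales2012, Lagarias2002LocalDensity, AldousLyons2007, arXiv:2006.14341,
Miekisz1998]
#3 PeriodicDefectPrice (crux) — the PERIODIC SHADOW of X (primal feasibility on periodic laws; the
certified-numerics target both ways): the same P, and for all R, ε, θ > 0 a κ ∈ (0,1] and a periodic
near-minimiser Q₀ with e(Q) ≥ e(Q₀) + κ·(fraction of motif sites of Q whose (R,ε)-pattern in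
Q.points is not an isometric copy of P's − θ) for EVERY periodic configuration Q of ℝ³ (any lattice,
any motif; no separation hypothesis: close pairs pay r⁻¹²). Implied by X for 1/3-separated Q (apply
the certificate to large blocks of Q); refutable by explicit crystals; provable from below by
finite-level LPs + certified lattice sums. [difficulty: L] (why it might fail: False if
cheap-but-wrong crystals exist: a periodic family with non-P patterns on a fraction ≥ θ of sites and
excess energy → 0 (near-degenerate polytypes at large R, margins ~1e-5; tcp/Frank–Kasper phases only
~1.5e-2 above hcp), or no periodic near-minimiser is P-patterned.) [BlancLewin2015, Stillinger2001,
PartayOrtnerCsanyi2017, BeterminSamajTravenec2022, SchwerdtfegerBurrowsSmits2021,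
KaburagiKanamori1975]
#5 CrysPeriodicMinAttained (crux) — (shared item stmt-0627, the attainment half of conjunct (i), not
addressed by the LP mechanism and therefore an explicit load-bearing input) the infimum over
periodic configurations of ℝ³ of the Lennard-Jones energy per particle is attained;
HcpPeriodicMinimiser (stmt-3061, routes PoissonBesselStacking / LuttingerTiszaRegistry /
SymmetryRankLadder) implies it. [difficulty: open-problem] (why it might fail: Fails if the optimal
LJ stacking is aperiodic or the periodic infimum is not attained (Sturmian / most-homogeneous ground
states of the 1-D Hägg model with long-range couplings J_k; J_k certified only partially, hcp–fcc
margin 7e-5).) [BlancLewin2015, PartayOrtnerCsanyi2017, RadinSchulman1983, JedrzejewskiMiekisz2000,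
Literature.Barriers.AtomisticToContinuum.Hubbard1978_mostHomogeneous]
#9 TrialStateUpper (support) — (text of item stmt-3104) trial-state upper bound per periodic
configuration: for every periodic Q and ε > 0, eventually E(N)/N ≤ e(Q) + ε (finite blocks of Q as
N-point trial states; boundary O(N^{2/3}) particles lose O(1) each since site energies are bounded
by the summable r⁻⁶ tail). [difficulty: M] [BlancLewin2015]
#9 CrysEnergyLimit (support) — (shared item stmt-0626) E(N)/N converges to the infimum over periodic
configurations of the LJ energy per particle in d = 3; here DERIVED: CertificatesEnergyLimit.
[difficulty: open-problem] [BlancLewin2015]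
#9 BulkDefectVanish (support) — (shared hinge stmt-0751, verbatim; a crux of routes
PoissonBesselStacking / LuttingerTiszaRegistry, here DERIVED from X by counting:
CertificatesDefectVanish) one periodic P such that for every window R and tolerance ε, along every
sequence of LJ ground states all but o(N) particles have their R-neighbourhood ε-matched both ways
to an isometric copy of P's. [difficulty: open-problem] [BlancLewin2015, Hales2012]
#9 DefectVanishCrystallizes (support) — (shared item stmt-0752, verbatim) soft assembly lemma:
BulkDefectVanish together with the uniform minimal distance of LJ ground states implies
IsCrystallizing lennardJones 3 (compactness of isometries, local bijection from the ε-matching,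
rotate lattice and motif). [difficulty: M] [BlancLewin2015]
#9 CertificatesEnergyLimit (support) — ENERGY HINGE (provable now): X → TrialStateUpper →
CrysPeriodicMinAttained → CrysEnergyLimit. Proof: ⨅ = e(P_min) by IsLeast.csInf_eq; upper half =
TrialStateUpper at P_min; lower half: for θ > 0 take any (R, ε) certificate: N·c ≤ Σ_i(½ site energy
+ transfers) − κ#bad ≤ E(N) (two_mul_interactionEnergy; the antisymmetric double sum vanishes;
ground states are δ-separated by X's first clause), so E(N)/N ≥ c ≥ e(Q) − κθ ≥ e(P_min) − θ for all
N ≥ 1. [difficulty: provable-now] [BlancLewin2015, LennardJonesClusters.lean]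
#9 CertificatesDefectVanish (support) — POSITIONAL HINGE (provable now, pure counting): X →
TrialStateUpper → BulkDefectVanish with the P of X. Proof: fix R, ε and θ > 0; the certificate
summed over a ground state gives N·c + κ·#bad_N ≤ E(N), so #bad_N/N ≤ (E(N)/N − c)/κ ≤ (E(N)/N −
e(Q))/κ + θ ≤ ε'/κ + θ eventually (TrialStateUpper at Q); θ, ε' arbitrary. [difficulty:
provable-now] [BlancLewin2015, LennardJonesClusters.lean]

TWO-LAYER PLAN. Foreseen glued split of #2 once #3 or TransferDuality moves (k = 3, depth 1):
PatternPricedCertificates ⇐ [PrimalRigidity: every minimising point-stationary hard-core law on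
rooted configurations of ℝ³ is supported on P-patterned configurations — the shared target
PalmRigidity (stmt-9224) of route PalmUnimodularRigidity, possibly in the weaker "P-patterned at
scale (R, ε)" form] → [TransferDuality: weak/strong duality between level-L certificates with price
κ and mass-transport-consistent rooted pattern laws, level values non-decreasing in L and converging
to the point-stationary value under ε-fattening] → [LevelLift: compactness turns "minimisers are
P-patterned" into "κ(θ) := min(1, inf{E_𝐏[h] − e* : 𝐏(bad) ≥ θ}) > 0" and picks the finite level].
Foreseen split of #3: [first-shell price at (R, ε) = (5/4, 1/20): certified LP at low level +
certified lattice sums] → [stacking price at R ≥ 2: Hägg domination with certified couplings, shared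
with PoissonBesselStacking 0737/3063] → #3.

KILL CRITERIA. (i) A refutation of PeriodicDefectPrice by an explicit periodic family (defect
fraction ≥ θ, excess
→ 0) closes the route `refuted:PeriodicDefectPrice`; if the family is 1/3-separated it refutes
PatternPricedCertificates outright (block argument). (ii) CrysPeriodicMinAttained refuted (aperiodic
optimal stacking / unattained infimum, the RefuteCrystalPeriodicMin line) kills conjunct (i) for
every route; this route then survives only as the positional engine (pivot: closes for
IsCrystallizing is not a thesis — retire). (iii) BulkDefectVanish refuted (a positive density of
non-P environments in LJ ground states, e.g. persistent stacking disorder) refutes X via the proved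
hinge + TrialStateUpper: pivot to the coarser pattern family (first two shells) feeding a kissing
back end (LJBarlowRigidity of BrittleRungDescent) or retire. (iv) A proof that level values stay
bounded away from the point-stationary value at fixed (R, ε, κ) (TransferDuality (ii) false) kills
the FINITE-LEVEL mechanism; X may survive at level ∞ only as PalmRigidity's dual — supersede by
PalmUnimodularRigidity. (v) PalmRigidity proved elsewhere does NOT moot the route (the finite level
and the counting hinge are extra content) but demotes #2 to an L-sized corollary of TransferDuality.

NOT DECOMPOSED YET. The form of Φ (two-tier: pattern-dependent near transfers + density-weighted
splitting of far pair
energies, which is what keeps the level below the naive far-field bound L ≳ (C(δ)/κθ)^{1/3}); the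
discretisation / Lipschitz-slack scheme, O(3) symmetry reduction and column generation of the
certified level-L LP; the tail-as-pressure lemma and any sharpening of δ = 1/3 (Blanc2004,
Yuhjtman2015 constants) that the COMPUTATION (not the statement) needs; equality cases /
complementary slackness; the primal refutation engine (lens-consistent pseudo-laws from icosahedral
/ polytetrahedral / Frank–Kasper local statistics) — a tool for refuters of low-level certificate
claims, not an item; TransferDuality itself (informal crux rank 4, filed right after open with
`workitem add`, typed by inlining the point-stationary encoding of stmt-9224 when a grounder wants
it). All wait for #3 or #4.

CHEAPEST FALSIFIER. Refute PeriodicDefectPrice at the first shell, (R, ε) = (5/4, 1/20), P = relaxed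
hcp (a* = 0.9712):
with certified lattice sums tabulate (e(Q) − e(hcp))/(bad-site fraction) for Q ∈ {fcc-twinned and
dhcp supercells (bad fraction 0 at this R — consistency check), vacancy supercells (≈ 0.05
expected), bcc (≈ 0.03), A15 / σ / C14 / C15 tcp phases (≈ 0.014), 3–5 % strained cells}; a family
driving the ratio below ~1e-3 with bad fraction ≥ 1/10 means the defect price is ~0 and X is dead at
that scale. Runner-up (lookup, uncertified numerics exist: Stillinger2001, PartayOrtnerCsanyi2017,
SchwerdtfegerBurrowsSmits2021): does relaxed hcp beat fcc AND every short-period polytype for the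
full 12-6 tail? If not, no single P exists and #2, #3, 0751 all die. I could not run either here
(hub is compute-free and `lit search` was unavailable this session; recorded in NOTES.md).

NUMBERS. V = r⁻¹²/12 − r⁻⁶/6, V(1) = −1/12; e* ≈ e(hcp) = −A₆²/(24A₁₂) = −0.7176 with A₆ = 14.4549,
A₁₂ =
12.1323, a* = (A₁₂/A₆)^{1/6} = 0.9712; e(fcc) − e(hcp) ≈ +7e-5; uniform strain s costs ≈ 25.8 s² per
particle (e'' = 3u/a*², u = 17.22), so κ at tolerance ε/a* is ≤ 25.8(ε/a*)²; vacancy ≈ 0.05 per bad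
first-shell site; A15/σ ≈ 1.5e-2 above hcp with 3/4 of sites Z14 ⇒ κ ≲ 0.014 there; stacking price
at pattern radius R: ≈ 7e-5·h/(2R) ≈ 3e-5/R; surface constraint on finite clusters κ ≤ σ/(ρR). δ =
1/3 proved; far-field slack of a ½–½ split: (π/9)Δρ·L⁻³ with Δρ ≤ √2/δ³ − ρ*: ≈ 13 L⁻³ at δ = 1/3, ≈
1.0 L⁻³ at δ = 0.68, so a rigid split needs L ≳ (C/κθ)^{1/3} ≈ 17 (δ = 1/3, κθ = 2.5e-3) resp. 7.4
(δ = 0.68); density-weighted far splitting brings the interface estimate to 0.54 L⁻³ ≤ 0.02, L ≈ 3.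
Truncated first levels (card, uncertified): bcc-type 8+6 beats every Barlow stacking for cutoffs in
~(1.13, 1.68); e_t(hcp) ≈ −0.67 at cutoff 2.1. All planner estimates, uncertified; items at open: 10
(+1 informal).

DEFINITION REQUESTS. None required by the typed items (PeriodicConfiguration, IsGroundState,
energyPerParticle,
LinearIsometry exist). For TransferDuality, the point-stationary rooted hard-core law is encoded
inline as in stmt-9224 (Measure (Measure ℝ³) + Mecke identity); a named notion `levelValue` (sup
over level-L pattern-local transfer rules) would be filed with `--topic
Summits/AtomisticToContinuum/Crystallization/Theorems` only if a grounder asks. Bib: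
VanheckeEtAl2021 (doi:10.1103/physrevresearch.3.013041) and TorquatoStillinger2006
(doi:10.1080/10586458.2006.10128964) prepared as .bib files in the planner folder (gate socket flaky
at filing; cited here by arXiv id / doi).

Novelty: Searches (2026-08-15): `lit galaxy search "m-potential" --star all` and `"m-potentials" --star all`
(noise only; Friedli–Velenik book
surfaced); `lit galaxy search --star pdf --mode bm25 "linear programming relaxation lower bound
ground state energy per particle … local correlation probabilities … dual gives local energy
inequality"` (15 hits: MRF/MAP LP relaxations — Sontag 2012 frustrated cycles, Wainwright–Jordan —
and ONE direct lattice precedent, arXiv:2006.14341 Vanhecke–Colbois–Vanderstraeten–Verstraete–Mila,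
"relieve the frustration … energy minimized independently on each cluster … weight on shared bonds …
a linear program", read pp. 1–2); `lit search` (local FTS + OpenAlex cascade) timed out twice this
session (searchd unavailable, D-0023) — not worked around; the card's and the gen-1 route's searches
(crossref/zbMATH/vsearch: 'configurational polytope' → alloy theory only; 'Kanamori continuum', 'LP
ground state continuum particles local correlations' → none) and two refuter novelty audits
(R2/R12/R14: Holsztyński–Slawny, Miękisz, Kaburagi–Kanamori, Huang 2016, Kull 2024, de
Laat–Vallentin, Torquato–Stillinger 2006 + Kuna–Lebowitz–Speer realizability) are inherited and
cited.
Nearest prior art found: HolsztynskiSlawny1978 (m-potentials = range-R certificates on lattices)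
with Miekisz1998 (lattice models with
no finite-range m-potential, "R* = ∞"); KaburagiKanamori1975 / HuangEtAl2016 / KullEtAl2024 (lattice
marginal polytopes and certified LP/SDP hierarchies); arXiv  [refs: 2006.14341, HolsztynskiSlawny1978, Miekisz1998, KaburagiKanamori1975, HuangEtAl2016, KullEtAl2024, DelaatVallentin2014, Laat2016, CohnLaatSalmon2022, CohnKumar2006, Hales2012]

Barriers (technique_class: marginal-LP-hierarchy; transfer-duality; certified-LP): - technique_class: marginal-LP-hierarchy; transfer-duality; certified-LP
- Literature.Barriers.AtomisticToContinuum.Li2022_cohnElkies3D: APPLIES to the pair-marginal level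
only (two-point LP has a duality gap for packing in d = 3); evaded by construction — the variables
are full rooted L-patterns with mass-transport consistency, of which the two-point program is the
lowest level; the bet is finite-level tightness UP TO A DEFECT BUDGET θ, never two-point sharpness.
- Literature.Barriers.AtomisticToContinuum.TetrahedralFrustration: APPLIES to raw single-cell levels
(pure Voronoi / Delaunay functionals are not sharp); the transfer rule Φ IS the reapportioning
(Lagarias's zero-sum corrections, Marchal/Flyspeck hybrid cells); the route does not evade
frustration by fiat — R*(R, ε, θ) measures the level at which it is resolved, and unresolved
frustration at finite level costs budget θ, not validity.
- Literature.Barriers.AtomisticToContinuum.IcosahedralClusters: APPLIES as a fact about finite N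
(LJ₁₃ icosahedral) and is used as a RESOURCE: icosahedral / polytetrahedral local statistics are the
primal witnesses against low-level certificates; the certificate inequality is pointwise with slack
at surfaces (κ ≤ 0.27 from half-spaces) and the conclusions are o(N) statements, so finite
icosahedral clusters contradict nothing.
- Literature.Barriers.AtomisticToContinuum.ShortRangeStackingBlindness: APPLIES to any certificate
built from a truncated potential of range < √(8/3)·a; evaded bec

History (route lifecycle, newest last):
- 2026-08-25T10:58:00Z · DORMANT — reconciler: no traction for 7.6 d (last activity item-evidence-added at 2026-08-17T19:12:49Z); parked, not closed — `ledger route dormant route-AtomisticToConti (operator:999:2261128)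
- 2026-08-31T09:27:43Z · REACTIVATED (open) — reconciler: reactivated — activity statement-checked at 2026-08-31T08:36:26Z after parking at 2026-08-25T10:58:00Z (operator:999:2618019)

sub-problem: Crystallization · status: open · opened planner-plancard-AtomisticToContinuum-Crystal-9bb6b7da-g2-0 2026-08-15T18:57:00Z · rev 1 · ledger route-AtomisticToContinuum-FrustrationRangeCertificates
GENERATED by the gate from the ledger (D-0016/17). Provers cite these decls: `theorem foo : Summit.AtomisticToContinuum.Crystallization.Theses.FrustrationRangeCertificates.<Decl> := …` in Summits/AtomisticToContinuum/Crystallization/Theorems/<Name>.lean.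
-/

namespace Summit.AtomisticToContinuum.Crystallization.Theses.FrustrationRangeCertificates

open scoped BigOperators Topology Manifold Classical MeasureTheory ProbabilityTheory Matrix InnerProductSpace ComplexConjugate ContinuousMap
open Filter Set Function TopologicalSpace MeasureTheory

attribute [summit_statement] _root_.Crystallization

/-- item stmt-AtomisticToContinuum-12974 · crux · rank 2 · open · by planner
why it might fail: Needs LJ's periodic minimiser pattern-unique with a POSITIVE price on every non-P environment at every scale (stacking: ~3e-5/R per site) and level values reaching the budget at finite L; a degenerate or aperiodic optimal stacking, a zero-cost defect, or an infinite-level duality gap kills it.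
sources: HolsztynskiSlawny1978, KaburagiKanamori1975, KullEtAl2024, HuangEtAl2016, Hales2012, Lagarias2002LocalDensity
[crux] thesis X (card items B1+B4, dual side): one periodic P such that for all R, ε, θ > 0 there
are δ > 0 (valid for all LJ ground states), a level L, c, κ ∈ (0,1], a pattern-local transfer rule Φ
and a periodic Q with e(Q) ≤ c + κθ, such that pointwise on every finite δ-separated configuration
½Σ_j V_LJ + (zero-sum transfers) ≥ c + κ·1[(R,ε)-pattern of i not an isometric copy of P's]
(predicate verbatim from stmt-0751). [difficulty: open-problem] -/
@[route_item "route-AtomisticToContinuum-FrustrationRangeCertificates", crux]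
def PatternPricedCertificates : Prop :=
  ∃ P : Literature.MathematicalPhysics.StatisticalMechanics.PeriodicConfiguration 3, ∀ R ε θ : ℝ, 0 < R → 0 < ε → 0 < θ → ∃ (δ L c κ : ℝ) (Φ : EuclideanSpace ℝ (Fin 3) → Finset (EuclideanSpace ℝ (Fin 3)) → Finset (EuclideanSpace ℝ (Fin 3)) → ℝ) (Q : Literature.MathematicalPhysics.StatisticalMechanics.PeriodicConfiguration 3), 0 < δ ∧ 0 < κ ∧ κ ≤ 1 ∧ (∀ (N : ℕ) (x : Fin N → EuclideanSpace ℝ (Fin 3)), Literature.MathematicalPhysics.StatisticalMechanics.IsGroundState Literature.MathematicalPhysics.StatisticalMechanics.lennardJones x → ∀ i j : Fin N, i ≠ j → δ ≤ dist (x i) (x j)) ∧ Q.energyPerParticle Literature.MathematicalPhysics.StatisticalMechanics.lennardJones ≤ c + κ * θ ∧ ∀ (N : ℕ) (x : Fin N → EuclideanSpace ℝ (Fin 3)), (∀ i j : Fin N, i ≠ j → δ ≤ dist (x i) (x j)) → let pat : Fin N → Finset (EuclideanSpace ℝ (Fin 3)) := fun i => Finset.image (fun k : Fin N => x k - x i)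 (Finset.univ.filter fun k : Fin N => k ≠ i ∧ dist (x i) (x k) ≤ L); ∀ i : Fin N, c + (if (∃ A : EuclideanSpace ℝ (Fin 3) →ₗᵢ[ℝ] EuclideanSpace ℝ (Fin 3), (∀ p ∈ P.points, ‖p‖ ≤ R → ∃ j : Fin N, dist (x j) (x i + A p) ≤ ε) ∧ (∀ j : Fin N, dist (x j) (x i) ≤ R → ∃ p ∈ P.points, dist (x j) (x i + A p) ≤ ε)) then 0 else κ) ≤ (∑ j ∈ Finset.univ.erase i, Literature.MathematicalPhysics.StatisticalMechanics.lennardJones (dist (x i) (x j))) / 2 + ∑ j ∈ Finset.univ.erase i, (Φ (x j - x i) (pat i) (pat j) - Φ (x i - x j) (pat j) (pat i))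

/-- item stmt-AtomisticToContinuum-12975 · crux · rank 3 · open · by planner
why it might fail: False if cheap-but-wrong crystals exist: a periodic family with non-P patterns on a fraction ≥ θ of sites and excess energy → 0 (near-degenerate polytypes at large R, margins ~1e-5; tcp/Frank–Kasper phases only ~1.5e-2 above hcp), or no periodic near-minimiser is P-patterned.
sources: BlancLewin2015, Stillinger2001, PartayOrtnerCsanyi2017, BeterminSamajTravenec2022, SchwerdtfegerBurrowsSmits2021, KaburagiKanamori1975
[crux] the PERIODIC SHADOW of X (primal feasibility on periodic laws; the certified-numerics target
both ways): the same P, and for all R, ε, θ > 0 a κ ∈ (0,1] and a periodic near-minimiser Q₀ with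
e(Q) ≥ e(Q₀) + κ·(fraction of motif sites of Q whose (R,ε)-pattern in Q.points is not an isometric
copy of P's − θ) for EVERY periodic configuration Q of ℝ³ (any lattice, any motif; no separation
hypothesis: close pairs pay r⁻¹²). Implied by X for 1/3-separated Q (apply the certificate to large
blocks of Q); refutable by explicit crystals; provable from below by finite-level LPs + certified
lattice sums. [difficulty: L] -/
@[route_item "route-AtomisticToContinuum-FrustrationRangeCertificates", crux]
def PeriodicDefectPrice : Prop :=
  ∃ P : Literature.MathematicalPhysics.StatisticalMechanics.PeriodicConfiguration 3, ∀ R ε θ : ℝ, 0 < R → 0 < ε → 0 < θ → ∃ κ : ℝ, 0 < κ ∧ κ ≤ 1 ∧ ∃ Q₀ : Literature.MathematicalPhysics.StatisticalMechanics.PeriodicConfiguration 3, ∀ Q : Literature.MathematicalPhysics.StatisticalMechanics.PeriodicConfiguration 3, Q₀.energyPerParticle Literature.MathematicalPhysics.StatisticalMechanics.lennardJones + κ * ((Set.ncard {y : EuclideanSpace ℝ (Fin 3) | y ∈ Q.motif ∧ ¬ ∃ A : EuclideanSpace ℝ (Fin 3) →ₗᵢ[ℝ] EuclideanSpace ℝ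 (Fin 3), (∀ p ∈ P.points, ‖p‖ ≤ R → ∃ z ∈ Q.points, dist z (y + A p) ≤ ε) ∧ (∀ z ∈ Q.points, dist z y ≤ R → ∃ p ∈ P.points, dist z (y + A p) ≤ ε)} : ℝ) / (Q.motif.card : ℝ) - θ) ≤ Q.energyPerParticle Literature.MathematicalPhysics.StatisticalMechanics.lennardJones

/-- item stmt-AtomisticToContinuum-0627 · crux · rank 5 · open · by planner
why it might fail: Fails if the optimal LJ stacking is aperiodic or the periodic infimum is not attained (Sturmian / most-homogeneous ground states of the 1-D Hägg model with long-range couplings J_k; J_k certified only partially, hcp–fcc margin 7e-5).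
sources: BlancLewin2015, PartayOrtnerCsanyi2017, RadinSchulman1983, JedrzejewskiMiekisz2000, Literature.Barriers.AtomisticToContinuum.Hubbard1978_mostHomogeneous
The infimum over periodic configurations of ℝ³ of the Lennard-Jones energy per particle is attained
(by some lattice G and finite motif F). Needs stacking selection (c) + compactness of near-optimal
periodic configurations at bounded density / bounded-below distances; refuted if optimal LJ
stackings are aperiodic with unattained infimum (route RefuteCrystalPeriodicMin). -/
@[route_item "route-AtomisticToContinuum-FrustrationRangeCertificates", crux]
def CrysPeriodicMinAttained : Prop :=
  ∃ P : Literature.MathematicalPhysics.StatisticalMechanics.PeriodicConfiguration 3, IsLeast (Set.range fun Q : Literature.MathematicalPhysics.StatisticalMechanics.PeriodicConfiguration 3 => Q.energyPerParticle Literature.MathematicalPhysics.StatisticalMechanics.lennardJones) (P.energyPerParticle Literature.MathematicalPhysics.StatisticalMechanics.lennardJones)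

-- item stmt-AtomisticToContinuum-12737 · support · rank 4 · open · by planner — informal only, no Lean statement yet:
--   [crux] TRANSFER DUALITY AND LEVEL CONVERGENCE (conceptual heart of card
--   frustration-range-lp-hierarchy; makes the frustration range well defined and is the bridge of the
--   foreseen split of PatternPricedCertificates). Fix δ > 0, the periodic P of
--   PatternPricedCertificates, a pattern test (R, ε) and a price κ ∈ [0, 1]. DUAL value at level L:
--   v_L(κ) := sup{c : there is a pattern-local transfer rule Φ(v, pat_L(i), pat_L(j)) with ½Σ_{j≠i}
--   V_LJ(|x_i−x_j|) + Σ_{j≠i}[Φ(i→j) − Φ(j→i)] ≥ c + κ·1[bad_{P,R,ε}(i)] at every particle of every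
--   finite δ-separated configuration of ℝ³} (bad = the defect predicate

/-- item stmt-AtomisticToContinuum-0626 · support · rank 9 · closed · proved by Summit.AtomisticToContinuum.Crystallization.Theorems.crysEnergyLimit_proof @ f456c3bab3f9 (prover) · by planner
sources: BlancLewin2015
Energetic crystallization: E(N)/N converges to the infimum over periodic (multi-lattice)
configurations of the LJ energy per particle in d = 3. Lower bound liminf ≥ ⨅ is the content ((a)
local optimality + (d) + surface term O(N^{2/3})); upper bound is filed separately. -/
@[route_item "route-AtomisticToContinuum-FrustrationRangeCertificates", crux]
def CrysEnergyLimit : Prop :=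
  Filter.Tendsto (fun N : ℕ => Literature.MathematicalPhysics.StatisticalMechanics.groundStateEnergy Literature.MathematicalPhysics.StatisticalMechanics.lennardJones 3 N / N) Filter.atTop (nhds (⨅ Q : Literature.MathematicalPhysics.StatisticalMechanics.PeriodicConfiguration 3, Q.energyPerParticle Literature.MathematicalPhysics.StatisticalMechanics.lennardJones))

/-- `CrysEnergyLimit` holds: proved by `Summit.AtomisticToContinuum.Crystallization.Theorems.crysEnergyLimit_proof` @ f456c3bab3f9. -/
theorem CrysEnergyLimit_holds : CrysEnergyLimit := _root_.Summit.AtomisticToContinuum.Crystallization.Theorems.crysEnergyLimit_proof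

/-- item stmt-AtomisticToContinuum-0751 · support · rank 9 · open · by planner
sources: BlancLewin2015, Hales2012
[crux] HINGE: there is ONE periodic configuration P (the LJ-optimal HCP-type stacking, 0 ∈ motif)
such that for every window radius R and tolerance ε, in every sequence of LJ ground states all but
o(N) particles i admit a linear isometry A with the particles in B_R(x_i) ε-matched both ways to x_i
+ A(P.points ∩ B_R). Follows from (K1) SoftTwelveCoordination + (K2) RobustFejesTothHales + (K3)
stacking selection (Hägg domination 0716/0737 + certified J_k) with ≤ K fault planes per ground
state. Sources: Hales2012 Thm 1; HaggStacking.lean; PartayOrtnerCsanyi2017. -/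
@[route_item "route-AtomisticToContinuum-FrustrationRangeCertificates", crux]
def BulkDefectVanish : Prop :=
  ∃ P : Literature.MathematicalPhysics.StatisticalMechanics.PeriodicConfiguration 3, ∀ R ε : ℝ, 0 < R → 0 < ε → ∀ x : (N : ℕ) → (Fin N → EuclideanSpace ℝ (Fin 3)), (∀ N, Literature.MathematicalPhysics.StatisticalMechanics.IsGroundState Literature.MathematicalPhysics.StatisticalMechanics.lennardJones (x N)) → Filter.Tendsto (fun N : ℕ => (Nat.card {i : Fin N // ¬ ∃ A : EuclideanSpace ℝ (Fin 3) →ₗᵢ[ℝ] EuclideanSpace ℝ (Fin 3), (∀ p ∈ P.points, ‖p‖ ≤ R → ∃ j : Fin N, dist (x N j) (x N i + A p) ≤ ε) ∧ (∀ j : Fin N, dist (x N j) (x N i) ≤ R → ∃ p ∈ P.points, dist (x N j) (x N i + A p) ≤ ε)} : ℝ) / N) Filter.atTop (nhds 0)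

/-- item stmt-AtomisticToContinuum-0752 · support · rank 9 · closed · proved by Summit.AtomisticToContinuum.Crystallization.Theorems.ThreeConeCertificateDefectVanishCrystallizes.defectVanishCrystallizes_proof (prover) · by planner
sources: BlancLewin2015
[support] SOFT ASSEMBLY LEMMA: BulkDefectVanish together with the uniform minimal distance of LJ
ground states (Literature fact LennardJonesMinimalDistance, Xue 1997 / BlancLewin2015 §2.2) implies
IsCrystallizing lennardJones 3: pick, for R_k = k, ε_k = 1/k, indices N_k ↑ and good particles i_k;
τ_k = −x_{i_k}; extract a convergent subsequence of the isometries A_k → A in O(3); minimal distance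
+ discreteness of P make the ε-matching a local bijection, so Σ_i f(x_i + τ_k) → Σ_{s ∈ A(P.points)}
f(s) for f ∈ C_c; A(P) is again a PeriodicConfiguration (rotate lattice and motif), multiplicity m ≡
1. -/
@[route_item "route-AtomisticToContinuum-FrustrationRangeCertificates", crux]
def DefectVanishCrystallizes : Prop :=
  BulkDefectVanish → Literature.MathematicalPhysics.StatisticalMechanics.LennardJonesMinimalDistance → Literature.MathematicalPhysics.StatisticalMechanics.IsCrystallizing Literature.MathematicalPhysics.StatisticalMechanics.lennardJones 3

/-- `DefectVanishCrystallizes` holds: proved by `Summit.AtomisticToContinuum.Crystallization.Theorems.ThreeConeCertificateDefectVanishCrystallizes.defectVanishCrystallizes_proof`. -/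
theorem DefectVanishCrystallizes_holds : DefectVanishCrystallizes := _root_.Summit.AtomisticToContinuum.Crystallization.Theorems.ThreeConeCertificateDefectVanishCrystallizes.defectVanishCrystallizes_proof

/-- item stmt-AtomisticToContinuum-11963 · support · rank 9 · closed · proved by Summit.AtomisticToContinuum.Crystallization.Theorems.trialStateUpper_proof @ cbf57c235ebf (prover) · by planner
sources: BlancLewin2015
[support] TRIAL-STATE UPPER BOUND per periodic configuration (gen-1 item 3104, refuter-reviewed
TRUE/M): for every periodic Q and ε > 0, eventually E(N)/N ≤ e(Q) + ε (finite blocks of Q as N-point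
trial states: boundary O(N^{2/3}) particles lose O(1) each since site energies are bounded by the
summable r⁻⁶ tail, hasSum_lennardJones_dist_three in tree; groundStateEnergy_lennardJones_le needs
no BddBelow). Gives limsup E(N)/N ≤ ⨅_Q e(Q). [difficulty: M] -/
@[route_item "route-AtomisticToContinuum-FrustrationRangeCertificates", crux]
def TrialStateUpper : Prop :=
  ∀ (Q : Literature.MathematicalPhysics.StatisticalMechanics.PeriodicConfiguration 3) (ε : ℝ), 0 < ε → ∀ᶠ N : ℕ in Filter.atTop, Literature.MathematicalPhysics.StatisticalMechanics.groundStateEnergy Literature.MathematicalPhysics.StatisticalMechanics.lennardJones 3 N / N ≤ Q.energyPerParticle Literature.MathematicalPhysics.StatisticalMechanics.lennardJones + ε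

/-- `TrialStateUpper` holds: proved by `Summit.AtomisticToContinuum.Crystallization.Theorems.trialStateUpper_proof` @ cbf57c235ebf. -/
theorem TrialStateUpper_holds : TrialStateUpper := _root_.Summit.AtomisticToContinuum.Crystallization.Theorems.trialStateUpper_proof

/-- item stmt-AtomisticToContinuum-12976 · support · rank 9 · closed · proved by Summit.AtomisticToContinuum.Crystallization.Theorems.certificatesEnergyLimit_proof @ c0fff55834b9 (prover) · by planner
sources: BlancLewin2015, LennardJonesClusters.lean
[support] ENERGY HINGE (provable now): X → TrialStateUpper → CrysPeriodicMinAttained →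
CrysEnergyLimit. Proof: ⨅ = e(P_min) by IsLeast.csInf_eq; upper half = TrialStateUpper at P_min;
lower half: for θ > 0 take any (R, ε) certificate: N·c ≤ Σ_i(½ site energy + transfers) − κ#bad ≤
E(N) (two_mul_interactionEnergy; the antisymmetric double sum vanishes; ground states are
δ-separated by X's first clause), so E(N)/N ≥ c ≥ e(Q) − κθ ≥ e(P_min) − θ for all N ≥ 1.
[difficulty: provable-now] -/
@[route_item "route-AtomisticToContinuum-FrustrationRangeCertificates", crux]
def CertificatesEnergyLimit : Prop :=
  PatternPricedCertificates → TrialStateUpper → CrysPeriodicMinAttained → CrysEnergyLimit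

-- `CertificatesEnergyLimit` holds: proved by `Summit.AtomisticToContinuum.Crystallization.Theorems.certificatesEnergyLimit_proof` @ c0fff55834b9 (its module imports this route file, so no `_holds` link can be stated here).

/-- item stmt-AtomisticToContinuum-12977 · support · rank 9 · closed · proved by Summit.AtomisticToContinuum.Crystallization.Theorems.certificatesDefectVanish_proof @ e492a491f934 (prover) · by planner
sources: BlancLewin2015, LennardJonesClusters.lean
[support] POSITIONAL HINGE (provable now, pure counting): X → TrialStateUpper → BulkDefectVanish
with the P of X. Proof: fix R, ε and θ > 0; the certificate summed over a ground state gives N·c +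
κ·#bad_N ≤ E(N), so #bad_N/N ≤ (E(N)/N − c)/κ ≤ (E(N)/N − e(Q))/κ + θ ≤ ε'/κ + θ eventually
(TrialStateUpper at Q); θ, ε' arbitrary. [difficulty: provable-now] -/
@[route_item "route-AtomisticToContinuum-FrustrationRangeCertificates", crux]
def CertificatesDefectVanish : Prop :=
  PatternPricedCertificates → TrialStateUpper → BulkDefectVanish

-- `CertificatesDefectVanish` holds: proved by `Summit.AtomisticToContinuum.Crystallization.Theorems.certificatesDefectVanish_proof` @ e492a491f934 (its module imports this route file, so no `_holds` link can be stated here).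

/-- item stmt-AtomisticToContinuum-12978 · assembly · rank 1 · closed · proved by Summit.AtomisticToContinuum.Crystallization.Theorems.frustrationRangeCertificates_assembly_proof @ f593d99468fd (prover) · by planner
sources: BlancLewin2015
[assembly] PatternPricedCertificates → TrialStateUpper → CrysPeriodicMinAttained →
CertificatesEnergyLimit → CertificatesDefectVanish → DefectVanishCrystallizes → Crystallization. -/
@[route_item "route-AtomisticToContinuum-FrustrationRangeCertificates", crux]
def Assembly : Prop :=
  PatternPricedCertificates → TrialStateUpper → CrysPeriodicMinAttained → CertificatesEnergyLimit → CertificatesDefectVanish → DefectVanishCrystallizes → _root_.Crystallization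

-- `Assembly` holds: proved by `Summit.AtomisticToContinuum.Crystallization.Theorems.frustrationRangeCertificates_assembly_proof` @ f593d99468fd (its module imports this route file, so no `_holds` link can be stated here).

/-! D-0027 §2.1 — DECIDING THEOREM (planner-authored via `route open/edit --closes-file`; by planner-plancard-AtomisticToContinuum-Crystal-9bb6b7da-g2-0 2026-08-15T18:57:00Z):
its hypotheses are this route's items and its conclusion the sub-problem Statement (glue_lint), and it elaborates with this file. -/

@[closes "route-AtomisticToContinuum-FrustrationRangeCertificates"] theorem closes (hC : PatternPricedCertificates) (hPDP : PeriodicDefectPrice) (hMin : CrysPeriodicMinAttained) (hU : TrialStateUpper) (h0626 : CrysEnergyLimit) (h0751 : BulkDefectVanish) (hDVC : DefectVanishCrystallizes) (hE : CertificatesEnergyLimit) (hD : CertificatesDefectVanish) (hA : Assembly) : _root_.Crystallization := by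
  obtain ⟨P, hP⟩ := hMin
  have hlim := hE hC hU ⟨P, hP⟩
  refine ⟨⟨P, hP, ?_⟩, hDVC (hD hC hU) Literature.MathematicalPhysics.StatisticalMechanics.LennardJonesMinimalDistance_holds⟩
  unfold CrysEnergyLimit at hlim
  rw [← sInf_range, hP.csInf_eq] at hlim
  exact hlim

end Summit.AtomisticToContinuum.Crystallization.Theses.FrustrationRangeCertificates
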